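import Literature.Probability.Percolation.KestenRelationRussoAlt
import Literature.Probability.Percolation.OneArmPivotalSumGen
import HarnessLib

/-!
# The upper half of Werner's Lemma 6.2 for the rhombus with a four-arm KERNEL, and `Werner2009_lemma62` from the alternating hypotheses (proofs only)

Topic `Literature/Probability/Percolation`; family `crit-perc`. PROOFS ONLY (no definition, no
named fact). Sequel of `KestenRelationRussoAlt.lean` for the named fact `Werner2009_lemma62`
(`KestenRelationRusso.lean`; W. Werner, *Lectures on two-dimensional critical percolation*,
IAS/Park City Math. Ser. 16 (2009), Lecture 6, Lemma 6.2 read for the rhombus `[0, N]²` as in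
P. Nolin, EJP 13 (2008), §7.3, proof of Prop. 34 and Remark 35 [arXiv 0711.4948: Prop. 32,
Remark 34]).

`RhombusPivotalSumBounds.lean` proved the upper half of Lemma 6.2 for the rhombus,
`Σ_{v ∈ [0,N]²} P_t(v pivotal for 𝒞_H([0,N]²)) ≤ C N² π̂_t(r₀, N)` below `L(t, ε)`
(`rhombusPivotalSum_upper_W`), from the ORDER-FREE named facts `Werner2009_fourArm_quasiMult`
(Cor. 6.2) and `Werner2009_fourArm_lowerBound` (§3), the four-arm probability entering through
(i) the per-site bounds `P_t(v pivotal) ≤ π̂_t(r₀, d)` (interior) and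
`P_t(v pivotal) ≤ π̂_t(r₀, i) · P_t(B_{T,F})` (near a side), and (ii) the ratio bound
`π̂(r₀, d) ≤ cst (N/d)^{2-β} π̂(r₀, N)` from quasi-multiplicativity and the a priori lower bound.
Werner's `π̂_p` is the ALTERNATING four-arm probability, and the tree now has both inputs for a
kernel: the per-site bounds with `π̂^alt` (`measureReal_isPivotal_triLRCrossing_le_altFourArmProbAt`,
`KestenRelationRussoAlt.lean`; `para_pivotal_three_le_alt` below) and the ratio bound for any
antitone non-negative kernel (`kernel_le_ratio_mul`, `OneArmPivotalSumGen.lean`). This file runs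
the summation of `RhombusPivotalSumBounds.lean` for a kernel and closes the alternating route:

* `para_pivotal_three_le_alt` — the boundary three-factor bound of `ParaPivotalBoundary.lean`
  with the local four arms in the alternating cluster form:
  `P_t(v pivotal for LR(m, n)) ≤ π̂^alt_t(r₀, i) · P_t(domArmEvent ![T,F] (r' + i) (R₂ - i) upperHalfPlane)`
  (`relabel_shift_mem_altFourArm_of_isPivotal`, independence on disjoint site sets);
* `wide_site_envelope_le_gen`, `rhombusPivotalSum_upper_gen` — the per-site envelope and the
  summed upper bound of `RhombusPivotalSumBounds.lean` for any kernel `Q_t(r, R) ≥ 0` antitone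
  in `R`, given per-site bounds of the two kinds above with `Q`, quasi-multiplicativity and the a
  priori lower bound for `Q` below `L(t, ε)` (the shapes of `Werner2009_fourArm_quasiMult`,
  `Werner2009_fourArm_lowerBound`), the half-plane two-arm bound being the theorem
  `Werner2009_halfPlane_twoArm_holds`;
* `rhombusPivotalSum_upper_alt` — **the upper half of Lemma 6.2 for the rhombus as printed**:
  `Σ_v P_t(v pivotal) ≤ C N² π̂^alt_t(r₀, N)` for `1/2 ≤ t < 1/2 + δ`, `n₁ ≤ N ≤ L(t, ε)`, from
  quasi-multiplicativity and the a priori bound for `π̂^alt` below `L(p)` (Werner's Cor. 6.2 and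
  §3, third estimate, both about his alternating `π̂`; Nolin's Prop. 17 and Thm. 24 (ii) with
  Prop. 12 for `σ = BWBW`) — the hypotheses `hQM`, `hLB` of `Nolin2008_thm27_oneArm_of_altHyps`
  (`NearCriticalOneArmFromAltFacts.lean`), verbatim; an `example` recovers the order-free
  `rhombusPivotalSum_upper_W` (with the half-plane fact discharged);
* `Werner2009_lemma62_of_altSeparation_of_altHyps`, `Werner2009_lemma62_of_altHyps` —
  **`Werner2009_lemma62` from the alternating four-arm calculus below `L(p)`**: alternating
  separation `(hsepA)` (Werner's Prop. 6.1 / Nolin's Thm. 11, `σ = BWBW`) or directly the rhombus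
  interior pivotal lower bound with `π̂^alt`, quasi-multiplicativity and the a priori bound for
  `π̂^alt` (Cor. 6.2, §3), the alternating Lemma 6.3 (Nolin's Thm. 27 for `σ = BWBW`), and the
  fixed-radius comparison of the two arrangements at `p = 1/2` (Nolin's Prop. 20, `j = 4`) — the
  only input about the adjacent arrangement, needed because the fact's `π₄ = critFourArmProb` is
  order-free.

All hypotheses are displayed `∀∃` statements; nothing is weakened and no named fact is
introduced (D-0026).

## References

* W. Werner, *Lectures on two-dimensional critical percolation*, IAS/Park City Math. Ser. 16
  (2009), Lecture 6, §3 (a priori estimates), §4 (Prop. 6.1, Cor. 6.2), §5 (Lemma 6.2 and its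
  proof, Lemma 6.3) [arXiv 0710.0856, pp. 44–48] [WernerPCMI2009].
* P. Nolin, Near-critical percolation in two dimensions, *Electron. J. Probab.* 13 (2008)
  1562–1623, Thm. 11, Prop. 12, Prop. 17, §5.1 Prop. 20, Thm. 24, Thm. 27, §7.3 Prop. 34 (proof,
  (7.21)–(7.24)) and Remark 35 (arXiv 0711.4948: Thm. 10, Prop. 11, Prop. 16, Prop. 19, Thm. 23,
  Thm. 26, Prop. 32, Remark 34) [Nolin2008].
* H. Kesten, Scaling relations for 2D-percolation, *Comm. Math. Phys.* 109 (1987) 109–156,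
  Lemma 8 [KestenScalingCMP1987].

Tree: `relabel_shift_mem_altFourArm_of_isPivotal`, `measureReal_isPivotal_triLRCrossing_le_altFourArmProbAt`,
`rhombusPivotalSum_lower_alt_of_altSeparation`, `Werner2009_lemma62_of_alt`,
`Werner2009_lemma62_of_altSeparation_of_altUpper_of_altStability` (`KestenRelationRussoAlt.lean`),
`kernel_le_ratio_mul` (`OneArmPivotalSumGen.lean`), `para_pivotal_two_le`,
`exists_rot_halfPlane_superset_rect`, `shift_mem_domArmEvent_openClosed` (`ParaPivotalBoundary.lean`),
`shift_mem_domArmEvent_recenter`, `real_domArmEvent_rotPow` (`OneArmBoundaryArms.lean`),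
`determinedBy_preimage_shift_altFourArm` (`CutPointAltArms.lean`), `determinedBy_preimage_shift`,
`relabel_shift_shift` (`OneArmPivotalLayer.lean`), `sum_rectangle_le_envelope`,
`sum_layer_envelope_le`, `sum_shallow_envelope_le` (`ParaPivotalSumBounds.lean`),
`rhombusPivotalSum_lower_of_pointwise_gen`, `Werner2009_halfPlane_twoArm_holds`
(`HalfPlaneTwoArmRadiiNearCritical.lean`), `altFourArmProbAt_nonneg`, `altFourArmProbAt_anti`.
-/

noncomputable section

open MeasureTheory Set Finset Real

namespace Literature.Probability.Percolation

open LatticeModels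
open scoped unitInterval

/-! ### The boundary three-factor bound with the alternating local arms -/

section Bounds

variable {m n i r' R₂ r₀ : ℕ} {v : Site 2}

/-- **Two factors for a pivotal site of the parallelogram, alternating local arms** (Werner 2009,
Lecture 6, proof of Lemma 6.2, upper bound): the statement of `para_pivotal_three_le`
(`ParaPivotalBoundary.lean`) with Werner's alternating `π̂^alt_t(r₀, i) = altFourArmProbAt t r₀ i`
in place of the order-free `π̂_t(r₀, i)`. With `i` the distance from `v` to the nearest side,
`1 ≤ r₀ ≤ i`, `i + 1 ≤ r'`, `r' + 2i + 1 ≤ R₂`, `R₂` at most the two far distances,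
`P_t(v pivotal for LR(m, n)) ≤ π̂^alt_t(r₀, i) · P_t(domArmEvent ![T,F] (r' + i) (R₂ - i) upperHalfPlane)`:
the local four alternating arms (`relabel_shift_mem_altFourArm_of_isPivotal`) and the two long
arms (`shift_mem_domArmEvent_openClosed`, re-centred) live on disjoint site sets. [cite: WernerPCMI2009, Lecture 6, proof of Lemma 6.2 (upper bound, boundary contributions)] -/
theorem para_pivotal_three_le_alt (t : unitInterval)
    (hi : (i : ℤ) = v 0 ∨ (i : ℤ) = m - v 0 ∨ (i : ℤ) = v 1 ∨ (i : ℤ) = n - v 1)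
    (hi0 : (i : ℤ) ≤ v 0) (hi0' : v 0 + i ≤ m) (hi1 : (i : ℤ) ≤ v 1) (hi1' : v 1 + i ≤ n)
    (hr₀ : 1 ≤ r₀) (hr₀i : r₀ ≤ i) (hir' : i + 1 ≤ r') (hrec : r' + 2 * i + 1 ≤ R₂)
    (hR0 : (R₂ : ℤ) ≤ max (v 0) (m - v 0)) (hR1 : (R₂ : ℤ) ≤ max (v 1) (n - v 1)) :
    (triSitePercolation t).real {ω | IsPivotal (triLRCrossing m n) v ω} ≤
      altFourArmProbAt t r₀ i *
        (triSitePercolation t).real (domArmEvent ![true, false] (r' + i) (R₂ - i) upperHalfPlane) := by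
  classical
  obtain ⟨j, -, tt, htt, hdom⟩ := exists_rot_halfPlane_superset_rect (m := m) (n := n) v hi
  set G : Set (Site 2) := (triRotIsoPow j) '' upperHalfPlane with hG
  set B : Set (SiteConfig (Site 2)) :=
    SiteConfig.relabel (triShiftIso (-v)).toEquiv ⁻¹' altFourArm r₀ i with hB
  set C : Set (SiteConfig (Site 2)) :=
    SiteConfig.relabel (triShiftIso (-(v + tt))).toEquiv ⁻¹'
      domArmEvent ![true, false] (r' + i) (R₂ - i) G with hC
  have hincl : {ω : SiteConfig (Site 2) | IsPivotal (triLRCrossing m n) v ω} ⊆ B ∩ C := by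
    intro ω hω
    have hω' : IsPivotal (triLRCrossing m n) v ω := hω
    refine ⟨?_, ?_⟩
    · exact altFourArm_mono_left hr₀ hr₀i
        (relabel_shift_mem_altFourArm_of_isPivotal (hr₀.trans hr₀i) hi0 hi0' hi1 hi1' hω')
    · have h2 := shift_mem_domArmEvent_openClosed (r' := r') (R₂ := R₂) (by omega) (by omega) hR0 hR1 hω'
      have h3 := shift_mem_domArmEvent_recenter (κ := ![true, false]) (G := G) htt hrec hdom h2
      rw [relabel_shift_shift] at h3
      exact h3
  set G₁ : Finset (Site 2) := (triAnnulus r₀ i).image fun u => u + v with hG₁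
  set G₂ : Finset (Site 2) := (triAnnulus (r' + i) (R₂ - i)).image fun u => u + (v + tt) with hG₂
  have hBG : DeterminedBy B ↑G₁ := determinedBy_preimage_shift_altFourArm hr₀i v
  have hCG : DeterminedBy C ↑G₂ :=
    determinedBy_preimage_shift (determinedBy_domArmEvent _ (by omega) G) (v + tt)
  have hG₁G₂ : Disjoint G₁ G₂ := by
    rw [Finset.disjoint_left]
    intro z hz1 hz2
    rw [hG₁, Finset.mem_image] at hz1
    rw [hG₂, Finset.mem_image] at hz2
    obtain ⟨u, hu, rfl⟩ := hz1
    obtain ⟨u', hu', he'⟩ := hz2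
    rw [mem_triAnnulus] at hu hu'
    have h1 : u' + tt = u := by
      have : u' + (v + tt) = (u' + tt) + v := by abel
      rw [this] at he'; exact add_right_cancel he'
    have h2 := triNorm_add_le (u' + tt) (-tt)
    rw [add_neg_cancel_right, triNorm_neg, htt, h1] at h2
    omega
  have h2 : (triSitePercolation t).real (B ∩ C) =
      (triSitePercolation t).real B * (triSitePercolation t).real C :=
    sitePercolation_real_inter_of_disjoint t hBG hCG hG₁G₂
  have h3 : (triSitePercolation t).real B = altFourArmProbAt t r₀ i := by
    rw [altFourArmProbAt, hB, triSitePercolation]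
    exact sitePercolation_real_preimage_relabel _ t _
  have h4 : (triSitePercolation t).real C =
      (triSitePercolation t).real (domArmEvent ![true, false] (r' + i) (R₂ - i) upperHalfPlane) := by
    rw [hC, triSitePercolation, sitePercolation_real_preimage_relabel, hG]
    exact real_domArmEvent_rotPow t _ _ _ j
  calc (triSitePercolation t).real {ω | IsPivotal (triLRCrossing m n) v ω}
      ≤ (triSitePercolation t).real (B ∩ C) := measureReal_mono hincl
    _ = _ := by rw [h2, h3, h4]

end Bounds

/-! ### The per-site envelope for a kernel -/

/-- **The per-site bound through the distance to the nearest side, for `R(m, N)` with `N ≤ m`,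
with a four-arm KERNEL** (Werner 2009, proof of Lemma 6.2, upper bound): the statement and proof
of `wide_site_envelope_le` (`RhombusPivotalSumBounds.lean`) for a non-negative kernel
`q(r, R)`, antitone in `R`, that bounds pivotality in the two ways of `ParaPivotalArms.lean` /
`ParaPivotalBoundary.lean` (interior: `P_t(v pivotal) ≤ q(r₀, d)`; near a side:
`P_t(v pivotal) ≤ q(r₀, i) · P_t(B_{T,F}(r' + i, R₂ - i))`), is quasi-multiplicative and obeys the
a priori lower bound at the radii `≤ N`; the ratio bound is `kernel_le_ratio_mul`. The three
regimes: shallow rows `d < i₀` (two long arms only), layer `i₀ ≤ d`, `6d + 5 ≤ N` (three factors),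
bulk (local arms only). [cite: WernerPCMI2009, Lecture 6, proof of Lemma 6.2 (upper bound)] [cite: Nolin2008, §7.3, (7.21)–(7.24) (arXiv 0711.4948: proof of Prop. 32)] -/
theorem wide_site_envelope_le_gen {t : unitInterval} {q : ℕ → ℕ → ℝ} (hq0 : ∀ r R, 0 ≤ q r R)
    (hqa : ∀ r R R', r ≤ R → R ≤ R' → q r R' ≤ q r R)
    {m N r₀ rL n₀ i₀ : ℕ} {cQ cL CH β πN K Bc S : ℝ}
    (hm : N ≤ m) (hcQ : 0 < cQ) (hcL : 0 < cL) (hβ : 0 < β) (hβ2 : β ≤ 2) (hCH0 : 0 ≤ CH)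
    (hr1 : 1 ≤ r₀) (hi₀ : i₀ = 4 * r₀ + 1 + rL + n₀ + 1) (hN8 : 8000 ≤ N) (hNi : 40 * i₀ ≤ N)
    (hpiv4 : ∀ (v : Site 2) (d : ℕ), r₀ ≤ d → (d : ℤ) ≤ v 0 → v 0 + d ≤ (m : ℕ) →
      (d : ℤ) ≤ v 1 → v 1 + d ≤ (N : ℕ) →
        (triSitePercolation t).real {ω | IsPivotal (triLRCrossing m N) v ω} ≤ q r₀ d)
    (hpiv3 : ∀ (v : Site 2) (i r' R₂ : ℕ),
      ((i : ℤ) = v 0 ∨ (i : ℤ) = (m : ℕ) - v 0 ∨ (i : ℤ) = v 1 ∨ (i : ℤ) = (N : ℕ) - v 1) →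
      (i : ℤ) ≤ v 0 → v 0 + i ≤ (m : ℕ) → (i : ℤ) ≤ v 1 → v 1 + i ≤ (N : ℕ) →
      r₀ ≤ i → i + 1 ≤ r' → r' + 2 * i + 1 ≤ R₂ →
      (R₂ : ℤ) ≤ max (v 0) ((m : ℕ) - v 0) → (R₂ : ℤ) ≤ max (v 1) ((N : ℕ) - v 1) →
        (triSitePercolation t).real {ω | IsPivotal (triLRCrossing m N) v ω} ≤
          q r₀ i * (triSitePercolation t).real
            (domArmEvent ![true, false] (r' + i) (R₂ - i) upperHalfPlane))
    (hQt : ∀ R S : ℕ, 16 * r₀ < 4 * R → 4 * R < S → S ≤ N →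
      cQ * (q r₀ R * q (4 * R) S) ≤ q r₀ S)
    (hLt : ∀ m n : ℕ, rL ≤ m → m ≤ n → n ≤ N → cL * ((m : ℝ) / n) ^ (2 - β) ≤ q m n)
    (hHt : ∀ m n : ℕ, n₀ ≤ m → m ≤ n → n ≤ N →
      (triSitePercolation t).real (domArmEvent ![true, false] m n upperHalfPlane) ≤ CH * ((m : ℝ) / n))
    (hπNdef : πN = q r₀ N) (hK : K = 36 * CH / (cQ * cL)) (hBc : Bc = 196 / (cQ * cL))
    (hSdef : S = 3 * CH * (n₀ + 1 + i₀) / N) (v : Site 2) (d : ℕ)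
    (hd : (d : ℤ) = v 0 ∨ (d : ℤ) = (m : ℕ) - v 0 ∨ (d : ℤ) = v 1 ∨ (d : ℤ) = (N : ℕ) - v 1)
    (h0 : (d : ℤ) ≤ v 0) (h0' : v 0 + d ≤ (m : ℕ)) (h1 : (d : ℤ) ≤ v 1) (h1' : v 1 + d ≤ (N : ℕ)) :
    (triSitePercolation t).real {ω | IsPivotal (triLRCrossing m N) v ω} ≤
      (if d < i₀ then S else 0) + K * (((N : ℝ) / d) ^ (2 - β) * ((d : ℝ) / N)) * πN + Bc * πN := by
  have hN0 : (0 : ℝ) < N := by exact_mod_cast (show 0 < N by omega)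
  have hπN0 : 0 ≤ πN := by rw [hπNdef]; exact hq0 r₀ N
  have hS0 : 0 ≤ S := by rw [hSdef]; positivity
  have hK0 : 0 ≤ K := by rw [hK]; positivity
  have hBc0 : 0 ≤ Bc := by rw [hBc]; positivity
  have hR0 : ((N / 2 : ℕ) : ℤ) ≤ max (v 0) ((m : ℕ) - v 0) := by
    rw [le_max_iff]; push_cast; omega
  have hR1 : ((N / 2 : ℕ) : ℤ) ≤ max (v 1) ((N : ℕ) - v 1) := by
    rw [le_max_iff]; push_cast; omega
  have hdN : 2 * d ≤ N := by
    have : (2 * (d : ℤ)) ≤ N := by omega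
    exact_mod_cast this
  rcases lt_or_ge d i₀ with hdi | hdi
  · -- shallow: two factors
    have h2 := para_pivotal_two_le t (m := m) (n := N) (i := d) (r' := n₀ + 1) (R₂ := N / 2)
      hd (by omega) (by omega) hR0 hR1
    have hh := hHt (n₀ + 1 + d) (N / 2 - d) (by omega) (by omega) (by omega)
    have hrat : ((n₀ + 1 + d : ℕ) : ℝ) / ((N / 2 - d : ℕ) : ℝ) ≤ 3 * ((n₀ : ℝ) + 1 + i₀) / N := by
      have hden : (0 : ℝ) < ((N / 2 - d : ℕ) : ℝ) := by exact_mod_cast (show 0 < N / 2 - d by omega)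
      rw [div_le_div_iff₀ hden hN0]
      have key : (n₀ + 1 + d) * N ≤ 3 * (n₀ + 1 + i₀) * (N / 2 - d) := by
        have h5 : 2 * (N / 2) + 1 ≥ N := by omega
        have : (n₀ + 1 + d) * N ≤ (n₀ + 1 + i₀) * N := Nat.mul_le_mul_right _ (by omega)
        have : 3 * (n₀ + 1 + i₀) * (N / 2 - d) ≥ (n₀ + 1 + i₀) * N := by
          have : 3 * (N / 2 - d) ≥ N := by omega
          calc 3 * (n₀ + 1 + i₀) * (N / 2 - d) = (n₀ + 1 + i₀) * (3 * (N / 2 - d)) := by ring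
            _ ≥ (n₀ + 1 + i₀) * N := Nat.mul_le_mul_left _ this
        omega
      have : (((n₀ + 1 + d) * N : ℕ) : ℝ) ≤ ((3 * (n₀ + 1 + i₀) * (N / 2 - d) : ℕ) : ℝ) := by
        exact_mod_cast key
      push_cast at this ⊢
      linarith
    have hψd : S ≤ (if d < i₀ then S else 0) + K * (((N : ℝ) / d) ^ (2 - β) * ((d : ℝ) / N)) * πN + Bc * πN := by
      rw [if_pos hdi]
      have : 0 ≤ K * (((N : ℝ) / d) ^ (2 - β) * ((d : ℝ) / N)) * πN := by positivity
      have : 0 ≤ Bc * πN := by positivity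
      linarith
    refine le_trans ?_ hψd
    calc (triSitePercolation t).real {ω | IsPivotal (triLRCrossing m N) v ω}
        ≤ (triSitePercolation t).real
            (domArmEvent ![true, false] (n₀ + 1 + d) (N / 2 - d) upperHalfPlane) := h2
      _ ≤ CH * (((n₀ + 1 + d : ℕ) : ℝ) / ((N / 2 - d : ℕ) : ℝ)) := hh
      _ ≤ CH * (3 * ((n₀ : ℝ) + 1 + i₀) / N) := mul_le_mul_of_nonneg_left hrat hCH0
      _ = S := by rw [hSdef]; ring
  rcases le_or_gt (6 * d + 5) N with hdl | hdl
  · -- layer: three factors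
    have h3 := hpiv3 v d (d + 1) (N / 2) hd h0 h0' h1 h1' (by omega) le_rfl (by omega) hR0 hR1
    have hπ := kernel_le_ratio_mul hq0 hqa hcQ hcL hβ hβ2 hQt hLt (by omega) (by omega)
      (d := d) (by omega) (by omega) (by omega)
    rw [← hπNdef] at hπ
    have hh := hHt (d + 1 + d) (N / 2 - d) (by omega) (by omega) (by omega)
    have hrat : ((d + 1 + d : ℕ) : ℝ) / ((N / 2 - d : ℕ) : ℝ) ≤ 9 * ((d : ℝ) / N) := by
      have hden : (0 : ℝ) < ((N / 2 - d : ℕ) : ℝ) := by exact_mod_cast (show 0 < N / 2 - d by omega)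
      rw [mul_div_assoc', div_le_div_iff₀ hden hN0]
      have key : (d + 1 + d) * N ≤ 9 * d * (N / 2 - d) := by
        have hd1 : 1 ≤ d := by omega
        have h5 : 2 * (N / 2) + 1 ≥ N := by omega
        zify [show d ≤ N / 2 by omega] at h5 ⊢
        have hN2 : ((N / 2 : ℕ) : ℤ) ≥ 0 := by positivity
        nlinarith
      have : (((d + 1 + d) * N : ℕ) : ℝ) ≤ ((9 * d * (N / 2 - d) : ℕ) : ℝ) := by exact_mod_cast key
      push_cast at this ⊢
      linarith
    have hψd : K * (((N : ℝ) / d) ^ (2 - β) * ((d : ℝ) / N)) * πN ≤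
        (if d < i₀ then S else 0) + K * (((N : ℝ) / d) ^ (2 - β) * ((d : ℝ) / N)) * πN + Bc * πN := by
      have : 0 ≤ (if d < i₀ then S else 0) := by split_ifs <;> linarith
      have : 0 ≤ Bc * πN := by positivity
      linarith
    refine le_trans ?_ hψd
    have hX0 : (0 : ℝ) ≤ ((N : ℝ) / d) ^ (2 - β) := by positivity
    generalize ((N : ℝ) / d) ^ (2 - β) = X at hπ hX0 ⊢
    calc (triSitePercolation t).real {ω | IsPivotal (triLRCrossing m N) v ω}
        ≤ q r₀ d * (triSitePercolation t).real
            (domArmEvent ![true, false] (d + 1 + d) (N / 2 - d) upperHalfPlane) := h3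
      _ ≤ (4 / (cQ * cL) * X * πN) * (CH * (9 * ((d : ℝ) / N))) :=
          mul_le_mul hπ (hh.trans (mul_le_mul_of_nonneg_left hrat hCH0)) measureReal_nonneg
            (by positivity)
      _ = K * (X * ((d : ℝ) / N)) * πN := by rw [hK]; field_simp; ring
  · -- bulk: the local four arms only
    have hb := hpiv4 v d (by omega) h0 h0' h1 h1'
    have hπ := kernel_le_ratio_mul hq0 hqa hcQ hcL hβ hβ2 hQt hLt (by omega) (by omega)
      (d := d) (by omega) (by omega) (by omega)
    rw [← hπNdef] at hπ
    have hd0 : (0 : ℝ) < d := by exact_mod_cast (show 0 < d by omega)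
    have hNd : (1 : ℝ) ≤ (N : ℝ) / d := by
      rw [le_div_iff₀ hd0, one_mul]; exact_mod_cast (show d ≤ N by omega)
    have hNd7 : (N : ℝ) / d ≤ 7 := by
      rw [div_le_iff₀ hd0]; exact_mod_cast (show N ≤ 7 * d by omega)
    have hX : ((N : ℝ) / d) ^ (2 - β) ≤ 49 := by
      calc ((N : ℝ) / d) ^ (2 - β) ≤ ((N : ℝ) / d) ^ (2 : ℝ) :=
            Real.rpow_le_rpow_of_exponent_le hNd (by linarith)
        _ = ((N : ℝ) / d) ^ 2 := Real.rpow_two _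
        _ ≤ 7 ^ 2 := pow_le_pow_left₀ (by positivity) hNd7 2
        _ = 49 := by norm_num
    have hψd : Bc * πN ≤
        (if d < i₀ then S else 0) + K * (((N : ℝ) / d) ^ (2 - β) * ((d : ℝ) / N)) * πN + Bc * πN := by
      have : 0 ≤ (if d < i₀ then S else 0) := by split_ifs <;> linarith
      have : 0 ≤ K * (((N : ℝ) / d) ^ (2 - β) * ((d : ℝ) / N)) * πN := by positivity
      linarith
    refine le_trans ?_ hψd
    calc (triSitePercolation t).real {ω | IsPivotal (triLRCrossing m N) v ω}
        ≤ q r₀ d := hb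
      _ ≤ 4 / (cQ * cL) * ((N : ℝ) / d) ^ (2 - β) * πN := hπ
      _ ≤ 4 / (cQ * cL) * 49 * πN :=
          mul_le_mul_of_nonneg_right (mul_le_mul_of_nonneg_left hX (by positivity)) hπN0
      _ = Bc * πN := by rw [hBc]; ring

/-! ### The upper bound for the rhombus with a kernel, in Werner's conventions -/

/-- **The upper half of Lemma 6.2 for the rhombus below `L(p)`, for a four-arm kernel** (Werner
2009, Lecture 6, proof of Lemma 6.2: "the contributions due to those `x`'s that are close to the
edges … do not matter much"; Nolin 2008, Remark 35): the statement and proof of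
`rhombusPivotalSum_upper_W` (`RhombusPivotalSumBounds.lean`) for any kernel
`Q : unitInterval → ℕ → ℕ → ℝ`, non-negative and antitone in the outer radius, which bounds the
pivotality of a site of `R(m, n)` in the two ways of `hpiv4` (interior, local four arms) and
`hpiv3` (near a side, local four arms times two long arms in the half-plane), and which is
quasi-multiplicative (`hQM`, the shape of `Werner2009_fourArm_quasiMult`) and obeys the a priori
lower bound (`hLB`, the shape of `Werner2009_fourArm_lowerBound`) below `L(t, ε)`; the half-plane
two-arm bound is the theorem `Werner2009_halfPlane_twoArm_holds`. Conclusion: for every small `ε`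
and every large `r₀` there are `n₁`, `δ > 0`, `C` with
`Σ_{v ∈ [0,N]²} P_t(v pivotal for 𝒞_H([0,N]²)) ≤ C N² Q_t(r₀, N)` for `1/2 ≤ t < 1/2 + δ`, `n₁ ≤ N`,
`N ≤ L(t, ε)` if `t > 1/2`. [cite: WernerPCMI2009, Lecture 6, proof of Lemma 6.2 (upper bound)] [cite: Nolin2008, §7.3, Remark 35 and (7.21)–(7.24) (arXiv 0711.4948: Remark 34, proof of Prop. 32)] -/
theorem rhombusPivotalSum_upper_gen {Q : unitInterval → ℕ → ℕ → ℝ} (hQ0 : ∀ t r R, 0 ≤ Q t r R)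
    (hQa : ∀ t r R R', r ≤ R → R ≤ R' → Q t r R' ≤ Q t r R)
    (hpiv4 : ∀ (t : unitInterval) (m n r₀ d : ℕ) (v : Site 2), 1 ≤ r₀ → r₀ ≤ d →
      (d : ℤ) ≤ v 0 → v 0 + d ≤ (m : ℕ) → (d : ℤ) ≤ v 1 → v 1 + d ≤ (n : ℕ) →
        (triSitePercolation t).real {ω | IsPivotal (triLRCrossing m n) v ω} ≤ Q t r₀ d)
    (hpiv3 : ∀ (t : unitInterval) (m n r₀ : ℕ) (v : Site 2) (i r' R₂ : ℕ),
      ((i : ℤ) = v 0 ∨ (i : ℤ) = (m : ℕ) - v 0 ∨ (i : ℤ) = v 1 ∨ (i : ℤ) = (n : ℕ) - v 1) →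
      (i : ℤ) ≤ v 0 → v 0 + i ≤ (m : ℕ) → (i : ℤ) ≤ v 1 → v 1 + i ≤ (n : ℕ) →
      1 ≤ r₀ → r₀ ≤ i → i + 1 ≤ r' → r' + 2 * i + 1 ≤ R₂ →
      (R₂ : ℤ) ≤ max (v 0) ((m : ℕ) - v 0) → (R₂ : ℤ) ≤ max (v 1) ((n : ℕ) - v 1) →
        (triSitePercolation t).real {ω | IsPivotal (triLRCrossing m n) v ω} ≤
          Q t r₀ i * (triSitePercolation t).real
            (domArmEvent ![true, false] (r' + i) (R₂ - i) upperHalfPlane))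
    (hQM : ∃ ε₁ > (0 : ℝ), ∀ ⦃ε : ℝ⦄, 0 < ε → ε < ε₁ →
      ∃ r₁ : ℕ, ∃ δ > (0 : ℝ), ∃ c > (0 : ℝ),
        ∀ t : unitInterval, 1 / 2 ≤ (t : ℝ) → (t : ℝ) < 1 / 2 + δ →
          ∀ r R S : ℕ, r₁ ≤ r → 16 * r < 4 * R → 4 * R < S →
            (1 / 2 < (t : ℝ) → S ≤ charLengthW ε t) →
              c * (Q t r R * Q t (4 * R) S) ≤ Q t r S)
    (hLB : ∃ ε₁ > (0 : ℝ), ∀ ⦃ε : ℝ⦄, 0 < ε → ε < ε₁ →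
      ∃ r₁ : ℕ, ∃ δ > (0 : ℝ), ∃ β > (0 : ℝ), ∃ c > (0 : ℝ),
        ∀ t : unitInterval, 1 / 2 ≤ (t : ℝ) → (t : ℝ) < 1 / 2 + δ →
          ∀ m n : ℕ, r₁ ≤ m → m ≤ n → (1 / 2 < (t : ℝ) → n ≤ charLengthW ε t) →
            c * ((m : ℝ) / n) ^ (2 - β) ≤ Q t m n) :
    ∃ ε₁ > (0 : ℝ), ∀ ⦃ε : ℝ⦄, 0 < ε → ε < ε₁ →
      ∃ r₁ : ℕ, ∀ r₀ ≥ r₁, ∃ n₁ : ℕ, ∃ δ > (0 : ℝ), ∃ C : ℝ,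
        ∀ t : unitInterval, 1 / 2 ≤ (t : ℝ) → (t : ℝ) < 1 / 2 + δ →
          ∀ N : ℕ, n₁ ≤ N → (1 / 2 < (t : ℝ) → N ≤ charLengthW ε t) →
            rhombusPivotalSum t N ≤ C * ((N : ℝ) ^ 2 * Q t r₀ N) := by
  classical
  obtain ⟨εQ, hεQ, HQ⟩ := hQM
  obtain ⟨εL, hεL, HL⟩ := hLB
  obtain ⟨εH, hεH, HH⟩ := Werner2009_halfPlane_twoArm_holds
  refine ⟨min εQ (min εL εH), lt_min hεQ (lt_min hεL hεH), fun ε hε hε₁ => ?_⟩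
  obtain ⟨rQ, δQ, hδQ, cQ, hcQ, hQ⟩ := HQ hε (hε₁.trans_le (min_le_left _ _))
  obtain ⟨rL, δL, hδL, β₀, hβ₀, cL, hcL, hL⟩ :=
    HL hε (hε₁.trans_le ((min_le_right _ _).trans (min_le_left _ _)))
  obtain ⟨n₀, δH, hδH, CH, hH⟩ :=
    HH hε (hε₁.trans_le ((min_le_right _ _).trans (min_le_right _ _)))
  set β : ℝ := min β₀ 1 with hβdef
  have hβ : 0 < β := lt_min hβ₀ one_pos
  have hβ1 : β ≤ 1 := min_le_right _ _
  have hβ2 : β ≤ 2 := hβ1.trans one_le_two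
  have hββ₀ : β ≤ β₀ := min_le_left _ _
  refine ⟨max (max rQ rL) 1, fun r₀ hr₀ => ?_⟩
  have hrQ : rQ ≤ r₀ := ((le_max_left _ _).trans (le_max_left _ _)).trans hr₀
  have hrL : rL ≤ r₀ := ((le_max_right _ _).trans (le_max_left _ _)).trans hr₀
  have hr1 : 1 ≤ r₀ := (le_max_right _ _).trans hr₀
  obtain ⟨i₀, hi₀⟩ : ∃ i₀ : ℕ, i₀ = 4 * r₀ + 1 + rL + n₀ + 1 := ⟨_, rfl⟩
  -- `CH ≥ 0` from the half-plane bound at `t = 1/2`, `m = n = max n₀ 1`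
  have hCH0 : 0 ≤ CH := by
    have h := hH half (by rw [coe_half]) (by rw [coe_half]; linarith) (max n₀ 1) (max n₀ 1)
      (le_max_left _ _) le_rfl (fun h => by rw [coe_half] at h; exact absurd h (lt_irrefl _))
    have hne : ((max n₀ 1 : ℕ) : ℝ) ≠ 0 := Nat.cast_ne_zero.2 (by omega)
    rw [div_self hne, mul_one] at h
    exact measureReal_nonneg.trans h
  set K : ℝ := 36 * CH / (cQ * cL) with hK
  set Bc : ℝ := 196 / (cQ * cL) with hBc
  have hK0 : 0 ≤ K := by rw [hK]; positivity
  have hBc0 : 0 ≤ Bc := by rw [hBc]; positivity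
  refine ⟨max 8000 (40 * i₀), min δQ (min δL δH), lt_min hδQ (lt_min hδL hδH),
    10 * K * (1 + 1 / β) + 5 * Bc + 15 * CH * i₀ * (n₀ + 1 + i₀) / cL, fun t ht htδ N hN hNL => ?_⟩
  have hN8 : 8000 ≤ N := (le_max_left _ _).trans hN
  have hNi : 40 * i₀ ≤ N := (le_max_right _ _).trans hN
  have hN0 : (0 : ℝ) < N := by exact_mod_cast (show 0 < N by omega)
  have htQ : (t : ℝ) < 1 / 2 + δQ := htδ.trans_le (by gcongr; exact min_le_left _ _)
  have htL : (t : ℝ) < 1 / 2 + δL := htδ.trans_le (by gcongr; exact (min_le_right _ _).trans (min_le_left _ _))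
  have htH : (t : ℝ) < 1 / 2 + δH := htδ.trans_le (by gcongr; exact (min_le_right _ _).trans (min_le_right _ _))
  -- the hypotheses at `t`, radii `≤ N`
  have hQt : ∀ R S : ℕ, 16 * r₀ < 4 * R → 4 * R < S → S ≤ N →
      cQ * (Q t r₀ R * Q t (4 * R) S) ≤ Q t r₀ S :=
    fun R S h1 h2 h3 => hQ t ht htQ r₀ R S hrQ h1 h2 fun ht' => h3.trans (hNL ht')
  have hLt : ∀ m n : ℕ, rL ≤ m → m ≤ n → n ≤ N →
      cL * ((m : ℝ) / n) ^ (2 - β) ≤ Q t m n := by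
    intro m n h1 h2 h3
    have h := hL t ht htL m n h1 h2 fun ht' => h3.trans (hNL ht')
    refine le_trans (mul_le_mul_of_nonneg_left ?_ hcL.le) h
    rcases Nat.eq_zero_or_pos m with hm | hm
    · subst hm
      simp only [CharP.cast_eq_zero, zero_div]
      rw [Real.zero_rpow (ne_of_gt (by linarith))]
      exact Real.rpow_nonneg le_rfl _
    · have hn : 0 < n := by omega
      apply Real.rpow_le_rpow_of_exponent_ge
      · exact div_pos (by exact_mod_cast hm) (by exact_mod_cast hn)
      · rw [div_le_one (by exact_mod_cast hn)]; exact_mod_cast h2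
      · linarith
  have hHt : ∀ m n : ℕ, n₀ ≤ m → m ≤ n → n ≤ N →
      (triSitePercolation t).real (domArmEvent ![true, false] m n upperHalfPlane) ≤ CH * ((m : ℝ) / n) :=
    fun m n h1 h2 h3 => hH t ht htH m n h1 h2 fun ht' => h3.trans (hNL ht')
  obtain ⟨πN, hπNdef⟩ : ∃ x : ℝ, x = Q t r₀ N := ⟨_, rfl⟩
  rw [← hπNdef]
  have hπN0 : 0 ≤ πN := by rw [hπNdef]; exact hQ0 t r₀ N
  -- `N² Q(r₀, N) ≥ c_L`
  have hNπ : cL ≤ (N : ℝ) ^ 2 * πN := by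
    have h := hLt r₀ N hrL (by omega) le_rfl
    rw [← hπNdef] at h
    have hr0 : (0 : ℝ) < r₀ := by exact_mod_cast (show 0 < r₀ by omega)
    have hbase : (r₀ : ℝ) / N ≤ 1 := by rw [div_le_one hN0]; exact_mod_cast (show r₀ ≤ N by omega)
    have hb0 : (0 : ℝ) < (r₀ : ℝ) / N := div_pos hr0 hN0
    have h1 : ((r₀ : ℝ) / N) ^ (2 : ℝ) ≤ ((r₀ : ℝ) / N) ^ (2 - β) :=
      Real.rpow_le_rpow_of_exponent_ge hb0 hbase (by linarith)
    have h2 : (1 / (N : ℝ)) ^ 2 ≤ ((r₀ : ℝ) / N) ^ (2 : ℝ) := by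
      rw [Real.rpow_two]
      apply pow_le_pow_left₀ (by positivity)
      exact div_le_div_of_nonneg_right (by exact_mod_cast hr1) hN0.le
    have h3 : (N : ℝ) ^ 2 * (1 / (N : ℝ)) ^ 2 = 1 := by field_simp
    have h4 : cL = (N : ℝ) ^ 2 * (cL * (1 / (N : ℝ)) ^ 2) := by
      calc cL = cL * ((N : ℝ) ^ 2 * (1 / (N : ℝ)) ^ 2) := by rw [h3, mul_one]
        _ = (N : ℝ) ^ 2 * (cL * (1 / (N : ℝ)) ^ 2) := by ring
    calc cL = (N : ℝ) ^ 2 * (cL * (1 / (N : ℝ)) ^ 2) := h4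
      _ ≤ (N : ℝ) ^ 2 * (cL * ((r₀ : ℝ) / N) ^ (2 - β)) := by
          apply mul_le_mul_of_nonneg_left _ (by positivity)
          exact mul_le_mul_of_nonneg_left (h2.trans h1) hcL.le
      _ ≤ (N : ℝ) ^ 2 * πN := mul_le_mul_of_nonneg_left h (by positivity)
  -- the envelope
  set S : ℝ := 3 * CH * (n₀ + 1 + i₀) / N with hSdef
  have hS0 : 0 ≤ S := by rw [hSdef]; positivity
  set ψ : ℕ → ℝ := fun d => (if d < i₀ then S else 0) +
    K * (((N : ℝ) / d) ^ (2 - β) * ((d : ℝ) / N)) * πN + Bc * πN with hψ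
  have hψ0 : ∀ d, 0 ≤ ψ d := fun d => by
    rw [hψ]; dsimp only
    have : 0 ≤ (if d < i₀ then S else 0) := by split_ifs <;> linarith
    positivity
  -- the per-site bound through the depth
  have hsite : ∀ (v : Site 2) (d : ℕ),
      ((d : ℤ) = v 0 ∨ (d : ℤ) = (N : ℕ) - v 0 ∨ (d : ℤ) = v 1 ∨ (d : ℤ) = (N : ℕ) - v 1) →
      (d : ℤ) ≤ v 0 → v 0 + d ≤ (N : ℕ) → (d : ℤ) ≤ v 1 → v 1 + d ≤ (N : ℕ) →
      (triSitePercolation t).real {ω | IsPivotal (triLRCrossing N N) v ω} ≤ ψ d :=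
    fun v d hd h0 h0' h1 h1' => wide_site_envelope_le_gen (hQ0 t) (hQa t) le_rfl hcQ hcL hβ hβ2 hCH0
      hr1 hi₀ hN8 hNi
      (fun v d hrd h0 h0' h1 h1' => hpiv4 t N N r₀ d v hr1 hrd h0 h0' h1 h1')
      (fun v i r' R₂ hi hi0 hi0' hi1 hi1' hri hir hrec hR0 hR1 =>
        hpiv3 t N N r₀ v i r' R₂ hi hi0 hi0' hi1 hi1' hr1 hri hir hrec hR0 hR1)
      hQt hLt hHt hπNdef hK hBc hSdef v d hd h0 h0' h1 h1'
  -- the envelope hypothesis of `sum_rectangle_le_envelope`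
  have henv : ∀ a ≤ N, ∀ b ≤ N,
      (triSitePercolation t).real {ω | IsPivotal (triLRCrossing N N) ![(a : ℤ), (b : ℤ)] ω} ≤
        ψ a + ψ (N - a) + ψ b + ψ (N - b) := by
    intro a ha b hb
    -- the depth
    set d : ℕ := min (min a (N - a)) (min b (N - b)) with hd
    have hv0 : (![(a : ℤ), (b : ℤ)] : Site 2) 0 = a := rfl
    have hv1 : (![(a : ℤ), (b : ℤ)] : Site 2) 1 = b := rfl
    have hle : (triSitePercolation t).real
        {ω | IsPivotal (triLRCrossing N N) ![(a : ℤ), (b : ℤ)] ω} ≤ ψ d := by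
      apply hsite _ d
      · rw [hv0, hv1]
        rcases Nat.le_total (min a (N - a)) (min b (N - b)) with h | h
        · rcases Nat.le_total a (N - a) with h' | h'
          · left; rw [hd]; push_cast; omega
          · right; left; rw [hd]; push_cast; omega
        · rcases Nat.le_total b (N - b) with h' | h'
          · right; right; left; rw [hd]; push_cast; omega
          · right; right; right; rw [hd]; push_cast; omega
      all_goals rw [hd]; simp only [hv0, hv1]; push_cast; omega
    have hcases : d = a ∨ d = N - a ∨ d = b ∨ d = N - b := by rw [hd]; omega
    have g1 := hψ0 a; have g2 := hψ0 (N - a); have g3 := hψ0 b; have g4 := hψ0 (N - b)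
    rcases hcases with h | h | h | h <;> rw [h] at hle <;> linarith only [hle, g1, g2, g3, g4]
  -- summation over the depth
  have hsumψ : ∑ d ∈ Finset.range (N + 1), ψ d ≤
      i₀ * S + K * πN * (2 * (1 + 1 / β) * N) + (N + 1) * (Bc * πN) := by
    rw [hψ]
    rw [Finset.sum_add_distrib, Finset.sum_add_distrib, Finset.sum_const, Finset.card_range,
      nsmul_eq_mul]
    push_cast
    have h1 := sum_shallow_envelope_le hS0 i₀ N
    have h2 : ∑ d ∈ Finset.range (N + 1), K * (((N : ℝ) / d) ^ (2 - β) * ((d : ℝ) / N)) * πN ≤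
        K * πN * (2 * (1 + 1 / β) * N) := by
      have : ∑ d ∈ Finset.range (N + 1), K * (((N : ℝ) / d) ^ (2 - β) * ((d : ℝ) / N)) * πN =
          K * πN * ∑ d ∈ Finset.range (N + 1), ((N : ℝ) / d) ^ (2 - β) * ((d : ℝ) / N) := by
        rw [Finset.mul_sum]; refine Finset.sum_congr rfl fun d _ => ?_; ring
      rw [this]
      exact mul_le_mul_of_nonneg_left (sum_layer_envelope_le hβ hβ1 (by omega) (by omega) (by omega))
        (by positivity)
    linarith
  have htotal := sum_rectangle_le_envelope N N
    (fun v => (triSitePercolation t).real {ω | IsPivotal (triLRCrossing N N) v ω}) ψ henv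
  rw [rhombusPivotalSum]
  refine htotal.trans ?_
  have hΨ0 : 0 ≤ i₀ * S + K * πN * (2 * (1 + 1 / β) * N) := by positivity
  -- `i₀ S ≤ cst/N`-type term against `N² Q ≥ c_L`
  have h1 : (1 : ℝ) ≤ (N : ℝ) ^ 2 * πN / cL := by rw [le_div_iff₀ hcL, one_mul]; exact hNπ
  have hiS : (5 * N) * (i₀ * S) ≤ 15 * CH * i₀ * (n₀ + 1 + i₀) / cL * ((N : ℝ) ^ 2 * πN) := by
    have e1 : (5 * N) * (i₀ * S) = 15 * CH * i₀ * (n₀ + 1 + i₀) := by rw [hSdef]; field_simp; ring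
    rw [e1]
    have hc0 : 0 ≤ 15 * CH * (i₀ : ℝ) * (n₀ + 1 + i₀) := by positivity
    calc 15 * CH * (i₀ : ℝ) * (n₀ + 1 + i₀) = 15 * CH * i₀ * (n₀ + 1 + i₀) * 1 := by ring
      _ ≤ 15 * CH * i₀ * (n₀ + 1 + i₀) * ((N : ℝ) ^ 2 * πN / cL) := mul_le_mul_of_nonneg_left h1 hc0
      _ = 15 * CH * i₀ * (n₀ + 1 + i₀) / cL * ((N : ℝ) ^ 2 * πN) := by field_simp
  have hN9 : (9 : ℝ) ≤ N := by exact_mod_cast (show 9 ≤ N by omega)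
  set X : ℝ := i₀ * S + K * πN * (2 * (1 + 1 / β) * N) with hX
  set Y : ℝ := Bc * πN with hY
  have hY0 : 0 ≤ Y := by rw [hY]; positivity
  have hstep1 : 2 * ((N : ℝ) + 1) * ∑ a ∈ Finset.range (N + 1), ψ a +
      2 * ((N : ℕ) + 1 : ℝ) * ∑ b ∈ Finset.range (N + 1), ψ b ≤
      2 * ((N : ℝ) + 1) * (X + ((N : ℝ) + 1) * Y) + 2 * ((N : ℝ) + 1) * (X + ((N : ℝ) + 1) * Y) :=
    add_le_add (mul_le_mul_of_nonneg_left hsumψ (by positivity))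
      (mul_le_mul_of_nonneg_left hsumψ (by positivity))
  have hstep2 : 2 * ((N : ℝ) + 1) * (X + ((N : ℝ) + 1) * Y) + 2 * ((N : ℝ) + 1) * (X + ((N : ℝ) + 1) * Y) ≤
      5 * N * X + 5 * (N : ℝ) ^ 2 * Y := by
    have hNX : 0 ≤ ((N : ℝ) - 4) * X := mul_nonneg (by linarith only [hN9]) hΨ0
    have hNY : 0 ≤ ((N : ℝ) ^ 2 - 8 * N - 4) * Y := mul_nonneg (by nlinarith only [hN9]) hY0
    linear_combination hNX + hNY
  have hstep3 : 5 * (N : ℝ) * X + 5 * (N : ℝ) ^ 2 * Y ≤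
      (10 * K * (1 + 1 / β) + 5 * Bc + 15 * CH * i₀ * (n₀ + 1 + i₀) / cL) * ((N : ℝ) ^ 2 * πN) := by
    have e2 : 5 * (N : ℝ) * X = (5 * N) * (i₀ * S) + 10 * K * (1 + 1 / β) * ((N : ℝ) ^ 2 * πN) := by
      rw [hX]; ring
    have e3 : 5 * (N : ℝ) ^ 2 * Y = 5 * Bc * ((N : ℝ) ^ 2 * πN) := by rw [hY]; ring
    rw [e2, e3]
    linarith only [hiS]
  exact hstep1.trans (hstep2.trans hstep3)

/-- **The upper half of Werner's Lemma 6.2 for the rhombus, as printed (alternating `π̂`)**: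
IF `π̂^alt` is quasi-multiplicative below `L(p)` (Werner 2009, Cor. 6.2; Nolin 2008, Prop. 17 for
`σ = BWBW`) AND obeys the a priori bound `c (m/n)^{2-β} ≤ π̂^alt_t(m, n)` there (Werner 2009, §3,
third estimate; Nolin's Thm. 24 (ii) with Prop. 12) — the hypotheses `hQM`, `hLB` of
`Nolin2008_thm27_oneArm_of_altHyps` — THEN for every small `ε` and every large `r₀` there are
`n₁, δ > 0, C` with `Σ_{v ∈ [0,N]²} P_t(v pivotal for 𝒞_H([0,N]²)) ≤ C N² π̂^alt_t(r₀, N)` for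
`1/2 ≤ t < 1/2 + δ`, `n₁ ≤ N ≤ L(t, ε)`: `rhombusPivotalSum_upper_gen` at `Q = altFourArmProbAt`
with the alternating per-site bounds. [cite: WernerPCMI2009, Lecture 6, proof of Lemma 6.2 (upper bound), Cor. 6.2, §3] [cite: Nolin2008, §7.3, Remark 35, Prop. 17, Thm. 24 (arXiv 0711.4948: Remark 34, Prop. 16, Thm. 23)] -/
theorem rhombusPivotalSum_upper_alt
    (hQM : ∃ ε₁ > (0 : ℝ), ∀ ⦃ε : ℝ⦄, 0 < ε → ε < ε₁ →
      ∃ r₁ : ℕ, ∃ δ > (0 : ℝ), ∃ c > (0 : ℝ),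
        ∀ t : unitInterval, 1 / 2 ≤ (t : ℝ) → (t : ℝ) < 1 / 2 + δ →
          ∀ r R S : ℕ, r₁ ≤ r → 16 * r < 4 * R → 4 * R < S →
            (1 / 2 < (t : ℝ) → S ≤ charLengthW ε t) →
              c * (altFourArmProbAt t r R * altFourArmProbAt t (4 * R) S) ≤ altFourArmProbAt t r S)
    (hLB : ∃ ε₁ > (0 : ℝ), ∀ ⦃ε : ℝ⦄, 0 < ε → ε < ε₁ →
      ∃ r₁ : ℕ, ∃ δ > (0 : ℝ), ∃ β > (0 : ℝ), ∃ c > (0 : ℝ),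
        ∀ t : unitInterval, 1 / 2 ≤ (t : ℝ) → (t : ℝ) < 1 / 2 + δ →
          ∀ m n : ℕ, r₁ ≤ m → m ≤ n → (1 / 2 < (t : ℝ) → n ≤ charLengthW ε t) →
            c * ((m : ℝ) / n) ^ (2 - β) ≤ altFourArmProbAt t m n) :
    ∃ ε₁ > (0 : ℝ), ∀ ⦃ε : ℝ⦄, 0 < ε → ε < ε₁ →
      ∃ r₁ : ℕ, ∀ r₀ ≥ r₁, ∃ n₁ : ℕ, ∃ δ > (0 : ℝ), ∃ C : ℝ,
        ∀ t : unitInterval, 1 / 2 ≤ (t : ℝ) → (t : ℝ) < 1 / 2 + δ →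
          ∀ N : ℕ, n₁ ≤ N → (1 / 2 < (t : ℝ) → N ≤ charLengthW ε t) →
            rhombusPivotalSum t N ≤ C * ((N : ℝ) ^ 2 * altFourArmProbAt t r₀ N) :=
  rhombusPivotalSum_upper_gen (Q := altFourArmProbAt) altFourArmProbAt_nonneg
    (fun t r _ _ hr hR => altFourArmProbAt_anti t r hr hR)
    (fun t _ _ _ _ _ hr₀ hrd h0 h0' h1 h1' =>
      measureReal_isPivotal_triLRCrossing_le_altFourArmProbAt t hr₀ hrd h0 h0' h1 h1')
    (fun t _ _ _ _ _ _ _ hi hi0 hi0' hi1 hi1' hr₀ hr₀i hir hrec hR0 hR1 =>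
      para_pivotal_three_le_alt t hi hi0 hi0' hi1 hi1' hr₀ hr₀i hir hrec hR0 hR1)
    hQM hLB

/-- Sanity check (an `example`, not a second name): at the order-free kernel `Q = fourArmProbAt`
the kernel theorem, with the order-free per-site bounds of `ParaPivotalArms.lean` /
`ParaPivotalBoundary.lean`, gives back the statement of `rhombusPivotalSum_upper_W` (its half-plane
input being now the theorem `Werner2009_halfPlane_twoArm_holds`). -/
example (hQM : Werner2009_fourArm_quasiMult) (hLB : Werner2009_fourArm_lowerBound) :
    ∃ ε₁ > (0 : ℝ), ∀ ⦃ε : ℝ⦄, 0 < ε → ε < ε₁ →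
      ∃ r₁ : ℕ, ∀ r₀ ≥ r₁, ∃ n₁ : ℕ, ∃ δ > (0 : ℝ), ∃ C : ℝ,
        ∀ t : unitInterval, 1 / 2 ≤ (t : ℝ) → (t : ℝ) < 1 / 2 + δ →
          ∀ N : ℕ, n₁ ≤ N → (1 / 2 < (t : ℝ) → N ≤ charLengthW ε t) →
            rhombusPivotalSum t N ≤ C * ((N : ℝ) ^ 2 * fourArmProbAt t r₀ N) :=
  rhombusPivotalSum_upper_gen (Q := fourArmProbAt) fourArmProbAt_nonneg
    (fun t _ _ _ hr hR => fourArmProbAt_anti t hr hR)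
    (fun t _ _ _ _ _ hr₀ hrd h0 h0' h1 h1' =>
      measureReal_isPivotal_triLRCrossing_le_fourArmProbAt t hr₀ hrd h0 h0' h1 h1')
    (fun t _ _ _ _ _ _ _ hi hi0 hi0' hi1 hi1' hr₀ hr₀i hir hrec hR0 hR1 =>
      para_pivotal_three_le t hi hi0 hi0' hi1 hi1' hr₀ hr₀i hir hrec hR0 hR1)
    hQM hLB

/-! ### `Werner2009_lemma62` from the alternating four-arm calculus below `L(p)` -/

/-- **`Werner2009_lemma62` from alternating separation and the alternating hypotheses.** IF
(i) `c · π̂^alt_t(n, N) ≤ P_t(sepFourArm n N)` below `L(t, ε)` (Werner 2009, Prop. 6.1; Nolin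
2008, Thm. 11 for `σ = BWBW`), (ii) `π̂^alt` is quasi-multiplicative below `L(p)` (Cor. 6.2;
Nolin's Prop. 17), (iii) `c (m/n)^{2-β} ≤ π̂^alt_t(m, n)` below `L(p)` (§3, third estimate),
(iv) `c π̂^alt_{1/2}(r₀, N) ≤ π̂^alt_t(r₀, N) ≤ C π̂^alt_{1/2}(r₀, N)` below `L(t, ε)` (Lemma 6.3
as printed; Nolin's Thm. 27 for `σ = BWBW`), AND (v) `π₄(r₀, N) ≤ C(r₀) P_{1/2}(altFourArm r₀ N)`
for `N ≥ n₁(r₀)` (Nolin's Prop. 20 for `j = 4` at a fixed inner radius), THEN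
`Werner2009_lemma62`: the lower half of the alternating Lemma 6.2 for the rhombus from (i)
(`rhombusPivotalSum_lower_alt_of_altSeparation`), the upper half from (ii)–(iii)
(`rhombusPivotalSum_upper_alt`), then (iv)–(v)
(`Werner2009_lemma62_of_altSeparation_of_altUpper_of_altStability`). Inputs (i)–(iv) concern
Werner's alternating `π̂` only; (v) is the one input about the adjacent arrangement, present
because the fact compares with the order-free `π₄ = critFourArmProb`. [cite: WernerPCMI2009, Lecture 6, Prop. 6.1, Cor. 6.2, §3, Lemma 6.2, Lemma 6.3] [cite: Nolin2008, Thm. 11, Prop. 17, Thm. 24, Thm. 27, §5.1 Prop. 20, §7.3 Prop. 34 and Remark 35 (arXiv 0711.4948: Thm. 10, Prop. 16, Thm. 23, Thm. 26, Prop. 19, Prop. 32, Remark 34)] -/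
theorem Werner2009_lemma62_of_altSeparation_of_altHyps
    (hsepA : ∃ ε₁ > (0 : ℝ), ∀ ⦃ε : ℝ⦄, 0 < ε → ε < ε₁ →
      ∃ n₀ : ℕ, ∃ δ > (0 : ℝ), ∃ c > (0 : ℝ),
        ∀ t : unitInterval, 1 / 2 ≤ (t : ℝ) → (t : ℝ) < 1 / 2 + δ →
          ∀ n N : ℕ, n₀ ≤ n → 2 * n ≤ N → (1 / 2 < (t : ℝ) → N ≤ charLengthW ε t) →
            c * altFourArmProbAt t n N ≤ (triSitePercolation t).real (sepFourArm n N))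
    (hQM : ∃ ε₁ > (0 : ℝ), ∀ ⦃ε : ℝ⦄, 0 < ε → ε < ε₁ →
      ∃ r₁ : ℕ, ∃ δ > (0 : ℝ), ∃ c > (0 : ℝ),
        ∀ t : unitInterval, 1 / 2 ≤ (t : ℝ) → (t : ℝ) < 1 / 2 + δ →
          ∀ r R S : ℕ, r₁ ≤ r → 16 * r < 4 * R → 4 * R < S →
            (1 / 2 < (t : ℝ) → S ≤ charLengthW ε t) →
              c * (altFourArmProbAt t r R * altFourArmProbAt t (4 * R) S) ≤ altFourArmProbAt t r S)
    (hLB : ∃ ε₁ > (0 : ℝ), ∀ ⦃ε : ℝ⦄, 0 < ε → ε < ε₁ →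
      ∃ r₁ : ℕ, ∃ δ > (0 : ℝ), ∃ β > (0 : ℝ), ∃ c > (0 : ℝ),
        ∀ t : unitInterval, 1 / 2 ≤ (t : ℝ) → (t : ℝ) < 1 / 2 + δ →
          ∀ m n : ℕ, r₁ ≤ m → m ≤ n → (1 / 2 < (t : ℝ) → n ≤ charLengthW ε t) →
            c * ((m : ℝ) / n) ^ (2 - β) ≤ altFourArmProbAt t m n)
    (hS : ∃ ε₁ > (0 : ℝ), ∀ ⦃ε : ℝ⦄, 0 < ε → ε < ε₁ →
      ∃ r₁ : ℕ, ∀ r₀ ≥ r₁, ∃ n₁ : ℕ, ∃ δ > (0 : ℝ), ∃ c > (0 : ℝ), ∃ C : ℝ,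
        ∀ t : unitInterval, 1 / 2 ≤ (t : ℝ) → (t : ℝ) < 1 / 2 + δ →
          ∀ N : ℕ, n₁ ≤ N → (1 / 2 < (t : ℝ) → N ≤ charLengthW ε t) →
            c * altFourArmProbAt half r₀ N ≤ altFourArmProbAt t r₀ N ∧
              altFourArmProbAt t r₀ N ≤ C * altFourArmProbAt half r₀ N)
    (hB : ∃ r₁ : ℕ, ∀ r₀ ≥ r₁, ∃ n₁ : ℕ, ∃ C : ℝ, ∀ N : ℕ, n₁ ≤ N →
      critFourArmProb r₀ N ≤ C * altFourArmProbAt half r₀ N) :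
    Werner2009_lemma62 :=
  Werner2009_lemma62_of_altSeparation_of_altUpper_of_altStability hsepA
    (rhombusPivotalSum_upper_alt hQM hLB) hS hB

/-- **`Werner2009_lemma62` from the alternating hypotheses of the cone** — the three hypotheses of
`Nolin2008_thm27_oneArm_of_altHyps` read for the RHOMBUS (quasi-multiplicativity and the a priori
bound for `π̂^alt` below `L(p)`, and the interior pivotal lower bound
`c π̂^alt_t(r₀, N) ≤ P_t(v pivotal for LR(N, N))` for `N/4 < v₀, v₁ < 3N/4`; Werner 2009, Cor. 6.2,
§3, proof of Lemma 6.2; Nolin 2008, proof of Prop. 34, last display), the alternating Lemma 6.3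
and the fixed-radius bridge at `p = 1/2`. [cite: WernerPCMI2009, Lecture 6, Cor. 6.2, §3, Lemma 6.2 (proof), Lemma 6.3] [cite: Nolin2008, Prop. 17, Thm. 24, Thm. 27, §5.1 Prop. 20, §7.3 Prop. 34 (proof, last display) and Remark 35 (arXiv 0711.4948: Prop. 16, Thm. 23, Thm. 26, Prop. 19, Prop. 32, Remark 34)] -/
theorem Werner2009_lemma62_of_altHyps
    (hQM : ∃ ε₁ > (0 : ℝ), ∀ ⦃ε : ℝ⦄, 0 < ε → ε < ε₁ →
      ∃ r₁ : ℕ, ∃ δ > (0 : ℝ), ∃ c > (0 : ℝ),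
        ∀ t : unitInterval, 1 / 2 ≤ (t : ℝ) → (t : ℝ) < 1 / 2 + δ →
          ∀ r R S : ℕ, r₁ ≤ r → 16 * r < 4 * R → 4 * R < S →
            (1 / 2 < (t : ℝ) → S ≤ charLengthW ε t) →
              c * (altFourArmProbAt t r R * altFourArmProbAt t (4 * R) S) ≤ altFourArmProbAt t r S)
    (hLB : ∃ ε₁ > (0 : ℝ), ∀ ⦃ε : ℝ⦄, 0 < ε → ε < ε₁ →
      ∃ r₁ : ℕ, ∃ δ > (0 : ℝ), ∃ β > (0 : ℝ), ∃ c > (0 : ℝ),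
        ∀ t : unitInterval, 1 / 2 ≤ (t : ℝ) → (t : ℝ) < 1 / 2 + δ →
          ∀ m n : ℕ, r₁ ≤ m → m ≤ n → (1 / 2 < (t : ℝ) → n ≤ charLengthW ε t) →
            c * ((m : ℝ) / n) ^ (2 - β) ≤ altFourArmProbAt t m n)
    (hP : ∃ ε₁ > (0 : ℝ), ∀ ⦃ε : ℝ⦄, 0 < ε → ε < ε₁ →
      ∃ r₁ : ℕ, ∀ r₀ ≥ r₁, ∃ n₁ : ℕ, ∃ δ > (0 : ℝ), ∃ c > (0 : ℝ),
        ∀ t : unitInterval, 1 / 2 ≤ (t : ℝ) → (t : ℝ) < 1 / 2 + δ →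
          ∀ N : ℕ, n₁ ≤ N → (1 / 2 < (t : ℝ) → N ≤ charLengthW ε t) →
            ∀ v : Site 2, (N : ℤ) < 4 * v 0 → 4 * v 0 < 3 * N → (N : ℤ) < 4 * v 1 → 4 * v 1 < 3 * N →
              c * altFourArmProbAt t r₀ N ≤
                (triSitePercolation t).real {ω | IsPivotal (triLRCrossing N N) v ω})
    (hS : ∃ ε₁ > (0 : ℝ), ∀ ⦃ε : ℝ⦄, 0 < ε → ε < ε₁ →
      ∃ r₁ : ℕ, ∀ r₀ ≥ r₁, ∃ n₁ : ℕ, ∃ δ > (0 : ℝ), ∃ c > (0 : ℝ), ∃ C : ℝ,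
        ∀ t : unitInterval, 1 / 2 ≤ (t : ℝ) → (t : ℝ) < 1 / 2 + δ →
          ∀ N : ℕ, n₁ ≤ N → (1 / 2 < (t : ℝ) → N ≤ charLengthW ε t) →
            c * altFourArmProbAt half r₀ N ≤ altFourArmProbAt t r₀ N ∧
              altFourArmProbAt t r₀ N ≤ C * altFourArmProbAt half r₀ N)
    (hB : ∃ r₁ : ℕ, ∀ r₀ ≥ r₁, ∃ n₁ : ℕ, ∃ C : ℝ, ∀ N : ℕ, n₁ ≤ N →
      critFourArmProb r₀ N ≤ C * altFourArmProbAt half r₀ N) :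
    Werner2009_lemma62 := by
  refine Werner2009_lemma62_of_alt ?_ hS hB
  -- the two halves of the alternating Lemma 6.2 for the rhombus, combined
  obtain ⟨εL, hεL, HL⟩ := rhombusPivotalSum_lower_of_pointwise_gen altFourArmProbAt_nonneg hP
  obtain ⟨εU, hεU, HU⟩ := rhombusPivotalSum_upper_alt hQM hLB
  refine ⟨min εL εU, lt_min hεL hεU, fun ε hε hεlt => ?_⟩
  obtain ⟨rL, HL⟩ := HL hε (hεlt.trans_le (min_le_left _ _))
  obtain ⟨rU, HU⟩ := HU hε (hεlt.trans_le (min_le_right _ _))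
  refine ⟨max rL rU, fun r₀ hr₀ => ?_⟩
  obtain ⟨nL, δL, hδL, c, hc, HL⟩ := HL r₀ ((le_max_left _ _).trans hr₀)
  obtain ⟨nU, δU, hδU, C, HU⟩ := HU r₀ ((le_max_right _ _).trans hr₀)
  refine ⟨max nL nU, min δL δU, lt_min hδL hδU, c, hc, C, fun t ht1 ht2 N hN hNL => ⟨?_, ?_⟩⟩
  · exact HL t ht1 (by linarith [min_le_left δL δU]) N ((le_max_left _ _).trans hN) hNL
  · exact HU t ht1 (by linarith [min_le_right δL δU]) N ((le_max_right _ _).trans hN) hNL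

end Literature.Probability.Percolation

end
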